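/-
Copyright (c) 2026. All rights reserved.
Released under Apache 2.0 license as described in the file LICENSE.
Authors: abc-iut cell, statement-typer seat abc-iut-L4-t3 (wave 1).
-/
import Literature.AnabelianGeometry.AbsoluteAnabelian.DiagramsOfCategories
import Literature.AnabelianGeometry.AbsoluteAnabelian.Ltimes.LogFrobeniusCompatibility
import Literature.AnabelianGeometry.AbsoluteAnabelian.LogFrobeniusCorollaries
import HarnessLib

/-!
# [AbsTopIII] Corollary 5.5 (i)–(iv) and Corollary 5.10 (iv)(a)–(c): cores, telecores and observables of `D•⊢`

S. Mochizuki, *Topics in absolute anabelian geometry III: global reconstruction algorithms*,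
J. Math. Sci. Univ. Tokyo 22 (2015) 939–1156 [MochizukiAbsTopIII2015]; locators `p.N` = pages of the
author's manuscript (`paper:url-5493eb38cbb7`; journal pagination not held), read on the page: Cor 5.5 (i)–(iv)
pp. 130–131, Cor 5.10 (iv)(a)–(c) pp. 147–148.

Over a `LogFrobeniusSetting L` (`LogFrobeniusCompatibility.lean`: the categories and functors of Def 5.4 and the
SHAPE `DVertex`/`DEdge` of the diagram `D•⊢`), this file REALISES `D•⊢` and its full sub-diagrams `D•_{≤n}` as
diagrams of categories in the sense of Def 3.5 (i) (`DiagramOfCategories`, abc-iut-L4-t2's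
`DiagramsOfCategories.lean`) and states, with the Def 3.5 (ii)–(iv) notions of that file (`HomotopyFamily`,
`Observable`, `Observable.IsCore`, `Telecore`, `Telecore.IsContactStructure`):

* Cor 5.5 (i): "for `n = 5, 6, 7`, `D•_{≤n}` admits a natural structure of core on `D•_{≤n-1}`" = `Cor55Cores`
  (existence of a family of homotopies making the extension of `D•_{≤n-1}` by the row-`n` vertex a core);
* Cor 5.5 (ii): the telecore `𝔗_{An•}` on `D•_{≤5} ∪ {An•[𝒳]}` with telecore edges `φ_⋏ = φ_{An•} : An•[𝒳] → 𝒳_⋏`,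
  `⋏ ∈ L ∪ {□}`, and a contact structure on it = `Cor55Telecore` (the generating homotopies `η_{□⋎}, η_⋏^{±1}` are
  recorded only through "is a contact structure": TODO(general form));
* Cor 5.5 (iii): for each `v`, the `ι⊞_{v,ε}` belong to a family of homotopies determining an observable `S_log⊞`
  on `D•_{≤2}` with observation vertex `𝒩⊞_v` = `Cor55Observables` (the boundary pairs and the homotopies are PINNED
  to the printed paths and to `ι⊞_{v,ε}` componentwise; the `TS`-valued `S_log` with vertex `𝒩_v` likewise);
* Cor 5.5 (iv), the LOG-WALL: no core structure of `D•_{≤2}` on `D•_{≤1}` is compatible — inside one family of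
  homotopies on `D•⊢` — with such observables = `Cor55Incompatibility` (compatibility across sub-diagrams is
  expressed by embedding all families into one `HomotopyFamily` of the realised `D•⊢`, `CompatibleIn`);
* Cor 5.10 (iv)(a): the mono-analytic cores (`ℰ⊢`, `An⊢[𝒩⊢⊞]` "form cores") = `Cor510MonoCores`; (iv)(b), (c): the
  mono-analytic telecore from the core `An⊢[𝒩⊢⊞]` with edges `φ^{An⊢⊞}_{w,ν}` to `𝒩⊢⊞_w` and a contact structure
  containing the `η⊢_{v,ν}` = `Cor510MonoTelecore`.

NOT here (need Def 3.5 (v)–(vi): 1-morphisms / equivalences of diagrams, vertex- and edge-rigidity, nexus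
self-equivalences — not yet in `DiagramsOfCategories.lean`): Cor 5.5 (v) (`□` is a nexus, total `□`-rigidity, the
`ℤ`-action by nexus-classes of self-equivalences — only its combinatorial shadow `DVertex.shift` is typed), Cor 5.5
(vi) and Cor 5.10 (iii) (the panalocalization morphism `D⊚ → D✠` and its compatibilities). All statements are
parameterised by the interface `L`: they are ASSUMPTIONS on `L` that the text asserts for the genuine theaters (not
facts about an arbitrary `L`). Refereed pre-IUT material; nothing here bears on [IUTchIII] Cor. 3.12; typed ≠
discharged.

**`⋉`-TWIN (cell row «LTIMES-SUCCESSOR», L4-lead m162; typing finding T3g9-F1).**  This file is the verbatim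
re-elaboration of `LogFrobeniusCorollaries.lean` over the successor interface `LogFrobeniusSettingLtimes`
(`Ltimes/LogFrobeniusCompatibility.lean`: `ι⊞_{v,ε}` indexed by the edges of `Γ⃗^⋉_v` at EVERY place, [AbsTopIII] Cor 5.5 (iii)
p. 131), produced by the cell recipe `LTIMES-RECIPE.md`: names carry over inside `namespace LogFrobeniusSettingLtimes`, the
section variable is `Lt`, setting-independent declarations are NOT repeated (the originals are in scope), statements and
proofs are otherwise unchanged.  The original file over the frozen interface stays as it is.
-/

set_option autoImplicit false

universe u

open CategoryTheory Quiver

namespace Literature.AnabelianGeometry.AbsoluteAnabelian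

/-! ## `D•⊢` and its full sub-diagrams as diagrams of categories -/

section Realisation

variable {Vmod : Type u} {isArc : Vmod → Bool}

namespace LogFrobeniusSettingLtimes

variable (Lt : LogFrobeniusSettingLtimes Vmod isArc)

export LogFrobeniusSetting (core_mem_two row1_mem_two TelecoreIdx MonoTelecoreIdx)

/-- `D•⊢` as a diagram of categories (Def 3.5 (i)): the category `L`-realised at each vertex of `DVertex` and the
functor at each arrow of `DEdge`. [cite: MochizukiAbsTopIII2015, Cor 5.10 p. 146] -/
def diagram : DiagramOfCategories.{u, u + 1, u} (DVertex Vmod isArc) where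
  obj x := x.categoryLtimes Lt
  map e := DEdge.functorLtimes Lt e

/-- the full sub-diagram of `D•⊢` on the vertices satisfying `P`. [cite: MochizukiAbsTopIII2015, Cor 5.5 p. 130] -/
def subdiagram (P : DVertex Vmod isArc → Prop) : DiagramOfCategories.{u, u + 1, u} (DSub P) where
  obj x := x.1.categoryLtimes Lt
  map e := DEdge.functorLtimes Lt e

/-- the shape "sub-diagram on `P` extended by the vertex `x` as OBSERVATION vertex", with observation edges the arrows
of `D•⊢` into `x` (how `D•_{≤n}` is viewed as an extension of `D•_{≤n-1}` by its row-`n` vertex).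
[cite: MochizukiAbsTopIII2015, Cor 5.5 (i) p. 130] -/
def obsShape (P : DVertex Vmod isArc → Prop) (x : DVertex Vmod isArc) : ExtShape.{u} (DSub P) :=
  ⟨fun a => DEdge isArc a.1 x, fun _ => PEmpty.{u + 1}⟩

/-- the extension data: the category at `x` and the functors along the arrows into `x`.
[cite: MochizukiAbsTopIII2015, Cor 5.5 (i) p. 130] -/
def obsExt (P : DVertex Vmod isArc → Prop) (x : DVertex Vmod isArc) : (Lt.subdiagram P).ExtData (obsShape P x) where
  S := x.categoryLtimes Lt
  obsMap e := DEdge.functorLtimes Lt e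
  telMap j := PEmpty.elim j

/-- "`D_{≤P} ∪ {x}` admits a structure of core on `D_{≤P}`": some family of homotopies on the extended diagram, with
all boundary paths ending at `x`, makes it a core (Def 3.5 (iii)). [cite: MochizukiAbsTopIII2015, Cor 5.5 (i) p. 130] -/
def IsCoreOn (P : DVertex Vmod isArc → Prop) (x : DVertex Vmod isArc) : Prop :=
  ∃ (H : ((Lt.subdiagram P).extend (Lt.obsExt P x)).HomotopyFamily)
    (hH : ∀ ⦃a b : (obsShape P x).Vertex⦄ ⦃p q : Path a b⦄, H.E p q → b = (obsShape P x).obs),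
    (DiagramOfCategories.Observable.mk (obsShape P x) (fun _ => (inferInstance : IsEmpty PEmpty.{u + 1}))
      (Lt.obsExt P x) H hH).IsCore

/-! ## Corollary 5.5 (i) and Corollary 5.10 (iv)(a): cores -/

/-- **Cor 5.5 (i)**: "for `n = 5, 6, 7`, `D•_{≤n}` admits a natural structure of core on `D•_{≤n-1}`", i.e.
`ℰ•` (row 5), `An•[𝒳]` (row 6), `ℰ•` (row 7) "form cores" of the functors in `D•` (for `• = ⊚` the further core
`ℰ• → EA⊚[Z]` is not part of the shape typed here). [cite: MochizukiAbsTopIII2015, Cor 5.5 (i) p. 130] -/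
def Cor55Cores : Prop :=
  Lt.IsCoreOn (DVertex.InFirstRows 4) .e5 ∧ Lt.IsCoreOn (DVertex.InFirstRows 5) .an ∧
    Lt.IsCoreOn (DVertex.InFirstRows 6) .e7

/-- the vertices of `D•⊢_{≤n-1} ∪ D•_{≤n}` (mono-analytic rows `≤ n-1`, holomorphic rows `≤ n`).
[cite: MochizukiAbsTopIII2015, Cor 5.10 (iv)(a) p. 147] -/
def monoBase (n : ℕ) (x : DVertex Vmod isArc) : Prop :=
  (x.IsHolomorphic ∧ x.row ≤ n) ∨ (¬ x.IsHolomorphic ∧ x.row ≤ n - 1)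

/-- **Cor 5.10 (iv)(a)** (Mono-analytic Cores): "for `n = 5, 6, 7`, `D•⊢_{≤n}` admits a natural structure of core on
`D•⊢_{≤n-1} ∪ D•_{≤n}`", i.e. `ℰ⊢` (rows 5, 7) and `An⊢[𝒩⊢⊞]` (row 6) "form cores" of the functors in `D•⊢`.
[cite: MochizukiAbsTopIII2015, Cor 5.10 (iv)(a) p. 147] -/
def Cor510MonoCores : Prop :=
  Lt.IsCoreOn (monoBase 5) .emono5 ∧ Lt.IsCoreOn (monoBase 6) .anMono ∧ Lt.IsCoreOn (monoBase 7) .emono7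

/-! ## Embedding the extended sub-diagrams into `D•⊢`; compatibility of families of homotopies -/

/-- the inclusion of oriented graphs `Γ⃗_{D_{≤P} ∪ {x}} ↪ Γ⃗_{D•⊢}` (base vertices to themselves, the observation vertex to
`x`). [cite: MochizukiAbsTopIII2015, Cor 5.5 (iii) p. 131] -/
def embExt (P : DVertex Vmod isArc → Prop) (x : DVertex Vmod isArc) :
    (obsShape P x).Vertex ⥤q DVertex Vmod isArc where
  obj a := match a with
    | ExtVertex.base a => a.1
    | ExtVertex.obs => x
  map {a b} e := match a, b, e with
    | ExtVertex.base _, ExtVertex.base _, e => e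
    | ExtVertex.base _, ExtVertex.obs, i => i
    | ExtVertex.obs, ExtVertex.base _, j => PEmpty.elim j
    | ExtVertex.obs, ExtVertex.obs, e => PEmpty.elim e

/-- "compatible [i.e., whose constituent family of homotopies is compatible]" ACROSS sub-diagrams of `D•⊢`: a family
of homotopies `H` on `D_{≤P} ∪ {x}` is compatible with a family `K` on the whole of `D•⊢` if every boundary pair of `H`
maps to a boundary pair of `K` with the same homotopy (Def 3.5 (ii), "compatible families").
[cite: MochizukiAbsTopIII2015, Cor 5.5 (iv) p. 131] -/
def CompatibleIn (K : Lt.diagram.HomotopyFamily) {P : DVertex Vmod isArc → Prop} {x : DVertex Vmod isArc}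
    (H : ((Lt.subdiagram P).extend (Lt.obsExt P x)).HomotopyFamily) : Prop :=
  ∀ ⦃a b : (obsShape P x).Vertex⦄ (p q : Path a b) (h : H.E p q),
    ∃ h' : K.E ((embExt P x).mapPath p) ((embExt P x).mapPath q), HEq (H.η h) (K.η h')

/-! ## Corollary 5.5 (iii): the observables `S_log⊞`, `S_log` -/

/-- the shape of `S_log⊞` at `v`: `D•_{≤2}` with observation vertex `𝒩⊞_v`. [cite: MochizukiAbsTopIII2015, Cor 5.5 (iii) p. 131] -/
abbrev logShapePlus (v : Vmod) : ExtShape.{u} (DSub (DVertex.InFirstRows (isArc := isArc) 2)) :=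
  obsShape (DVertex.InFirstRows 2) (.nplus v)

/-- the extended diagram carrying `S_log⊞` at `v`. [cite: MochizukiAbsTopIII2015, Cor 5.5 (iii) p. 131] -/
abbrev logDiagramPlus (v : Vmod) :=
  (Lt.subdiagram (DVertex.InFirstRows 2)).extend (Lt.obsExt (DVertex.InFirstRows 2) (.nplus v))

/-- the observation edge `λ⊞_{v,ν} : □ → 𝒩⊞_v` of `S_log⊞` (`ν` pre-log). [cite: MochizukiAbsTopIII2015, Cor 5.5 p. 130] -/
def lamEdge (v : Vmod) (ν : LogVertex (isArc v)) (hν : ν.isPostLog = false) :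
    ((logShapePlus (isArc := isArc) v).base ⟨.core, core_mem_two⟩ ⟶ (logShapePlus (isArc := isArc) v).obs) :=
  DEdge.lam v ν hν

/-- the arrow `id_⋎ : 𝒳_⋎ → □` inside `D•_{≤2}`. [cite: MochizukiAbsTopIII2015, Cor 5.5 p. 130] -/
def toCoreEdge (v : Vmod) (n : ℤ) :
    ((logShapePlus (isArc := isArc) v).base ⟨.row1 n, row1_mem_two n⟩ ⟶
      (logShapePlus (isArc := isArc) v).base ⟨.core, core_mem_two⟩) :=
  DEdge.toCore n

/-- the arrow `log : 𝒳_{⋎+1} → 𝒳_⋎` inside `D•_{≤2}`. [cite: MochizukiAbsTopIII2015, Cor 5.5 p. 130] -/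
def logEdge (v : Vmod) (n : ℤ) :
    ((logShapePlus (isArc := isArc) v).base ⟨.row1 (n + 1), row1_mem_two (n + 1)⟩ ⟶
      (logShapePlus (isArc := isArc) v).base ⟨.row1 n, row1_mem_two n⟩) :=
  DEdge.log n

/-- the path `[λ⊞_{v,ν}]` of length 1 from `□` to `𝒩⊞_v`. [cite: MochizukiAbsTopIII2015, Cor 5.5 (iii) p. 131] -/
def lamPath (v : Vmod) (ν : LogVertex (isArc v)) (hν : ν.isPostLog = false) :
    Path ((logShapePlus (isArc := isArc) v).base ⟨.core, core_mem_two⟩) (logShapePlus (isArc := isArc) v).obs :=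
  Path.nil.cons (lamEdge v ν hν)

/-- the path `[λ⊞_{v,space-link}] ∘ [id_⋎] ∘ [log]` of length 3 from `𝒳_{⋎+1}` to `𝒩⊞_v` (the domain of `ι⊞_{v,ε}` for
`ε` leaving the post-log vertex, whose functor is identified with the space-link functor).
[cite: MochizukiAbsTopIII2015, Cor 5.5 (iii) p. 131] -/
def postLogDomPath (v : Vmod) (n : ℤ) (hsl : (LogVertex.spaceLink (isArc v)).isPostLog = false) :
    Path ((logShapePlus (isArc := isArc) v).base ⟨.row1 (n + 1), row1_mem_two (n + 1)⟩)
      (logShapePlus (isArc := isArc) v).obs :=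
  ((Path.nil.cons (logEdge v n)).cons (toCoreEdge v n)).cons (lamEdge v _ hsl)

/-- the path `[λ⊞_{v,ν₂}] ∘ [id_{⋎+1}]` of length 2 from `𝒳_{⋎+1}` to `𝒩⊞_v` (the codomain of such an `ι⊞_{v,ε}`).
[cite: MochizukiAbsTopIII2015, Cor 5.5 (iii) p. 131] -/
def postLogCodPath (v : Vmod) (n : ℤ) (ν : LogVertex (isArc v)) (hν : ν.isPostLog = false) :
    Path ((logShapePlus (isArc := isArc) v).base ⟨.row1 (n + 1), row1_mem_two (n + 1)⟩)
      (logShapePlus (isArc := isArc) v).obs :=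
  ((Path.nil.cons (toCoreEdge v (n + 1))).cons (lamEdge v ν hν))

/-- "the natural transformations `ι⊞_{v,ε}` belong to a family of homotopies on `D•_{≤3}` that determines … a structure
of observable `S_log⊞` on `D•_{≤2}`": the predicate on a family of homotopies `H` of the extended diagram
`D•_{≤2} ∪ {𝒩⊞_v}` — (1) all boundary paths end at `𝒩⊞_v` (observable), (2) for every admissible edge
`ε : ν₁ → ν₂` with `ν₁` pre-log the pair `([λ⊞_{v,ν₁}], [λ⊞_{v,ν₂}])` is a boundary pair whose homotopy is `ι⊞_{v,ε}`
(componentwise), (3) for `ε` leaving the post-log vertex and every `⋎ ∈ L` the pair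
`([λ⊞_{space-link}]∘[id_⋎]∘[log], [λ⊞_{ν₂}]∘[id_{⋎+1}])` is a boundary pair whose homotopy is `ι⊞_{v,ε}`.
[cite: MochizukiAbsTopIII2015, Cor 5.5 (iii) p. 131] -/
def IsLogObservablePlus (v : Vmod) (H : (Lt.logDiagramPlus v).HomotopyFamily) : Prop :=
  (∀ ⦃a b : (logShapePlus (isArc := isArc) v).Vertex⦄ ⦃p q : Path a b⦄, H.E p q →
      b = (logShapePlus (isArc := isArc) v).obs) ∧
  (∀ (ν₁ ν₂ : LogVertex (isArc v)) (ε : LogEdgeLtimes (isArc v) ν₁ ν₂) (h₁ : ν₁.isPostLog = false)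
      (h₂ : ν₂.isPostLog = false),
    ∃ hmem : H.E (lamPath v ν₁ h₁) (lamPath v ν₂ h₂),
      ∀ X₀ : Lt.X, ∃ (hobj : ((Lt.logDiagramPlus v).pathFunctor (lamPath v ν₁ h₁)).obj X₀ =
          (frobeniusTwist Lt.log ν₁.isPostLog ⋙ Lt.lam v ν₁).obj X₀)
        (hobj' : (Lt.lam v ν₂).obj X₀ = ((Lt.logDiagramPlus v).pathFunctor (lamPath v ν₂ h₂)).obj X₀),
        (H.η hmem).app X₀ = eqToHom hobj ≫ (Lt.iota v ε).app X₀ ≫ eqToHom hobj') ∧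
  (∀ (ν₁ ν₂ : LogVertex (isArc v)) (ε : LogEdgeLtimes (isArc v) ν₁ ν₂) (h₁ : ν₁.isPostLog = true)
      (h₂ : ν₂.isPostLog = false) (hsl : (LogVertex.spaceLink (isArc v)).isPostLog = false) (n : ℤ),
    ∃ hmem : H.E (postLogDomPath v n hsl) (postLogCodPath v n ν₂ h₂),
      ∀ X₀ : Lt.X, ∃ (hobj : ((Lt.logDiagramPlus v).pathFunctor (postLogDomPath v n hsl)).obj X₀ =
          (frobeniusTwist Lt.log ν₁.isPostLog ⋙ Lt.lam v ν₁).obj X₀)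
        (hobj' : (Lt.lam v ν₂).obj X₀ = ((Lt.logDiagramPlus v).pathFunctor (postLogCodPath v n ν₂ h₂)).obj X₀),
        (H.η hmem).app X₀ = eqToHom hobj ≫ (Lt.iota v ε).app X₀ ≫ eqToHom hobj')

/-- **Cor 5.5 (iii)** (the `⊞` half; the `TS`-valued observable `S_log` on the portion of `D•_{≤3}` indexed by `v`, with
observation vertex `𝒩_v`, is analogous and omitted here — TODO(general form)): for each `v ∈ V(F_mod)` the `ι⊞_{v,ε}`
belong to a family of homotopies determining an observable `S_log⊞` on `D•_{≤2}`.
[cite: MochizukiAbsTopIII2015, Cor 5.5 (iii) p. 131] -/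
def Cor55Observables : Prop := ∀ v : Vmod, ∃ H : (Lt.logDiagramPlus v).HomotopyFamily, Lt.IsLogObservablePlus v H

/-! ## Corollary 5.5 (iv): the log-wall -/

/-- **Cor 5.5 (iv), first sentence** (the LOG-WALL): "`D•_{≤2}` does NOT admit a structure of core on `D•_{≤1}` which
[i.e., whose constituent family of homotopies] is compatible with [the constituent family of homotopies of] the
observables `S_log`, `S_log⊞` of (iii)" — no core structure on `D•_{≤1} ∪ {□}` and observables as in (iii) embed into one
common family of homotopies on `D•⊢`.  ⊞ HALF ONLY (referee K1-F1): this file types the observable `S_log⊞`, not the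
mono-analytic `S_log` on the `𝒩_v`-portion (TODO(general form) above), so the typed `¬∃` asks compatibility with the
`S_log⊞` of every `v` only — formally STRONGER than print's non-existence of a core compatible with BOTH `S_log` and
`S_log⊞`; consumers must not read it as the printed (iv) verbatim.  (Second sentence — `𝔗_{An•}`, `ℋ_{An•}` and the
observables are not simultaneously compatible — needs families on the telecore diagram: TODO(general form).)
[cite: MochizukiAbsTopIII2015, Cor 5.5 (iv) p. 131] -/
def Cor55Incompatibility : Prop :=
  ¬ ∃ (Hc : ((Lt.subdiagram (DVertex.InFirstRows 1)).extend (Lt.obsExt (DVertex.InFirstRows 1) .core)).HomotopyFamily)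
      (hHc : ∀ ⦃a b : (obsShape (DVertex.InFirstRows (isArc := isArc) 1) DVertex.core).Vertex⦄ ⦃p q : Path a b⦄,
        Hc.E p q → b = (obsShape (DVertex.InFirstRows (isArc := isArc) 1) DVertex.core).obs)
      (K : Lt.diagram.HomotopyFamily) (Hobs : ∀ v : Vmod, (Lt.logDiagramPlus v).HomotopyFamily),
    (DiagramOfCategories.Observable.mk _ (fun _ => (inferInstance : IsEmpty PEmpty.{u + 1})) _ Hc hHc).IsCore ∧
      Lt.CompatibleIn K Hc ∧ ∀ v, Lt.IsLogObservablePlus v (Hobs v) ∧ Lt.CompatibleIn K (Hobs v)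

/-! ## Corollary 5.5 (ii): the telecore `𝔗_{An•}` -/

/-- the telecore functors: copies of the forgetful functor `φ_{An•} : An•[𝒳] → 𝒳`.
[cite: MochizukiAbsTopIII2015, Cor 5.5 (ii) p. 130] -/
def telecoreFun : (x : DVertex Vmod isArc) → TelecoreIdx x → (Lt.An ⥤ x.categoryLtimes Lt)
  | .row1 _, _ => Lt.φAn
  | .core, _ => Lt.φAn
  | .nplus _, j => PEmpty.elim j
  | .nv _, j => PEmpty.elim j
  | .e5, j => PEmpty.elim j
  | .an, j => PEmpty.elim j
  | .e7, j => PEmpty.elim j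
  | .nmonoPlus _, j => PEmpty.elim j
  | .nmono _, j => PEmpty.elim j
  | .emono5, j => PEmpty.elim j
  | .anMono, j => PEmpty.elim j
  | .emono7, j => PEmpty.elim j

/-- **Cor 5.5 (ii)**: the forgetful functor `φ_{An•}` gives rise to a telecore structure `𝔗_{An•}` — over the core of (i)
with core vertex `An•[𝒳]` — by appending telecore edges `φ_⋏ : An•[𝒳] → 𝒳_⋏`, `⋏ ∈ L ∪ {□}`, given by copies of
`φ_{An•}`; and the homotopies `η_{□⋎}, η_⋏^{±1}` generate a contact structure `ℋ_{An•}` on it (typed: existence of a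
telecore with these edges/functors admitting a contact structure; the generators are not pinned —
TODO(general form)). [cite: MochizukiAbsTopIII2015, Cor 5.5 (ii) pp. 130–131] -/
def Cor55Telecore : Prop :=
  ∃ (H : ((Lt.subdiagram (DVertex.InFirstRows 5)).extend (Lt.obsExt (DVertex.InFirstRows 5) .an)).HomotopyFamily)
    (hH : ∀ ⦃a b : (obsShape (DVertex.InFirstRows (isArc := isArc) 5) DVertex.an).Vertex⦄ ⦃p q : Path a b⦄,
      H.E p q → b = (obsShape (DVertex.InFirstRows (isArc := isArc) 5) DVertex.an).obs)
    (hc : (DiagramOfCategories.Observable.mk _ (fun _ => (inferInstance : IsEmpty PEmpty.{u + 1})) _ H hH).IsCore)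
    (T : DiagramOfCategories.Telecore _ _ hc),
    T.J = (fun a => TelecoreIdx a.1) ∧
      HEq (fun (a : DSub (DVertex.InFirstRows (isArc := isArc) 5)) (j : T.J a) => T.telMap j)
        (fun (a : DSub (DVertex.InFirstRows (isArc := isArc) 5)) (j : TelecoreIdx a.1) => Lt.telecoreFun a.1 j) ∧
      ∃ Hc, DiagramOfCategories.Telecore.IsContactStructure _ T Hc

/-! ## Corollary 5.10 (iv)(b), (c): the mono-analytic telecore `𝔗_{An⊢}` and contact structure `ℋ_{An⊢}` -/

/-- the mono-analytic telecore functors `φ^{An⊢⊞}_{w,ν}`. [cite: MochizukiAbsTopIII2015, Cor 5.10 (iv)(b) p. 147] -/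
def monoTelecoreFun : (x : DVertex Vmod isArc) → MonoTelecoreIdx x → (Lt.AnMono ⥤ x.categoryLtimes Lt)
  | .nmonoPlus w, j => Lt.ψAnMono w j.down
  | .row1 _, j => PEmpty.elim j
  | .core, j => PEmpty.elim j
  | .nplus _, j => PEmpty.elim j
  | .nv _, j => PEmpty.elim j
  | .e5, j => PEmpty.elim j
  | .an, j => PEmpty.elim j
  | .e7, j => PEmpty.elim j
  | .nmono _, j => PEmpty.elim j
  | .emono5, j => PEmpty.elim j
  | .anMono, j => PEmpty.elim j
  | .emono7, j => PEmpty.elim j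

/-- **Cor 5.10 (iv)(b)** (Mono-analytic Telecores): the restrictions `φ^{An⊢⊞}_{v,ν}` of the forgetful functors
`ψ^{An⊢⊞}_{v,ν}` give a telecore structure `𝔗_{An⊢}` over the mono-analytic core with core vertex `An⊢[𝒩⊢⊞]`
(Cor 5.10 (iv)(a), `n = 6`) by appending telecore edges from the core to row 3 of `D⊢`; with
**Cor 5.10 (iv)(c)**: a contact structure `ℋ_{An⊢}` on it in which, for each `v`, `ν ∈ Γ⃗^×_v`, the length-6 path
`□ →(λ⊞_{v,ν}) 𝒩⊞_v → 𝒩_v → ℰ• → ℰ⊢ → An⊢[𝒩⊢⊞] →(φ^{An⊢⊞}_{v,ν}) 𝒩⊢⊞_v` and the length-2 path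
`□ →(λ⊞_{v,ν}) 𝒩⊞_v → 𝒩⊢⊞_v` form a boundary pair in both orders (so their homotopy `η⊢_{v,ν}` is an isomorphism).
(The compatibility with `𝔗_{An•}`, `ℋ_{An•}`, `S_log`, `S_log⊞` — TODO(general form).)
[cite: MochizukiAbsTopIII2015, Cor 5.10 (iv)(b)(c) pp. 147–148] -/
def Cor510MonoTelecore : Prop :=
  ∃ (H : ((Lt.subdiagram (monoBase (isArc := isArc) 6)).extend (Lt.obsExt (monoBase 6) .anMono)).HomotopyFamily)
    (hH : ∀ ⦃a b : (obsShape (monoBase (isArc := isArc) 6) DVertex.anMono).Vertex⦄ ⦃p q : Path a b⦄,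
      H.E p q → b = (obsShape (monoBase (isArc := isArc) 6) DVertex.anMono).obs)
    (hc : (DiagramOfCategories.Observable.mk _ (fun _ => (inferInstance : IsEmpty PEmpty.{u + 1})) _ H hH).IsCore)
    (T : DiagramOfCategories.Telecore _ _ hc),
    T.J = (fun a => MonoTelecoreIdx a.1) ∧
      HEq (fun (a : DSub (monoBase (isArc := isArc) 6)) (j : T.J a) => T.telMap j)
        (fun (a : DSub (monoBase (isArc := isArc) 6)) (j : MonoTelecoreIdx a.1) => Lt.monoTelecoreFun a.1 j) ∧
      ∃ Hc : ((Lt.subdiagram (monoBase (isArc := isArc) 6)).extend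
          (X := ⟨(obsShape (monoBase (isArc := isArc) 6) DVertex.anMono).I, T.J⟩)
          ⟨Lt.AnMono, fun e => DEdge.functorLtimes Lt e, T.telMap⟩).HomotopyFamily,
        DiagramOfCategories.Telecore.IsContactStructure _ T Hc ∧
        ∀ (v : Vmod) (ν : LogVertex (isArc v)) (hν : ν.IsCross)
          (hcore : monoBase (isArc := isArc) 6 .core) (hnp : monoBase (isArc := isArc) 6 (.nplus v))
          (hnv : monoBase (isArc := isArc) 6 (.nv v)) (he5 : monoBase (isArc := isArc) 6 .e5)
          (hem : monoBase (isArc := isArc) 6 .emono5) (hnm : monoBase (isArc := isArc) 6 (.nmonoPlus v))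
          (j : T.J ⟨.nmonoPlus v, hnm⟩),
          let X' : ExtShape.{u} (DSub (monoBase (isArc := isArc) 6)) :=
            ⟨(obsShape (monoBase (isArc := isArc) 6) DVertex.anMono).I, T.J⟩
          let γ₁ : Path (X'.base ⟨.core, hcore⟩) (X'.base ⟨.nmonoPlus v, hnm⟩) :=
            ((((((Path.nil.cons (show X'.base ⟨.core, hcore⟩ ⟶ X'.base ⟨.nplus v, hnp⟩ from DEdge.lam v ν hν.1)).cons
              (show X'.base ⟨.nplus v, hnp⟩ ⟶ X'.base ⟨.nv v, hnv⟩ from DEdge.forget v)).cons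
              (show X'.base ⟨.nv v, hnv⟩ ⟶ X'.base ⟨.e5, he5⟩ from DEdge.toE v)).cons
              (show X'.base ⟨.e5, he5⟩ ⟶ X'.base ⟨.emono5, hem⟩ from DEdge.monoE5)).cons
              (show X'.base ⟨.emono5, hem⟩ ⟶ X'.obs from DEdge.κAnMono)).cons
              (show X'.obs ⟶ X'.base ⟨.nmonoPlus v, hnm⟩ from j))
          let γ₀ : Path (X'.base ⟨.core, hcore⟩) (X'.base ⟨.nmonoPlus v, hnm⟩) :=
            ((Path.nil.cons (show X'.base ⟨.core, hcore⟩ ⟶ X'.base ⟨.nplus v, hnp⟩ from DEdge.lam v ν hν.1)).cons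
              (show X'.base ⟨.nplus v, hnp⟩ ⟶ X'.base ⟨.nmonoPlus v, hnm⟩ from DEdge.monoNplus v))
          Hc.E γ₁ γ₀ ∧ Hc.E γ₀ γ₁

end LogFrobeniusSettingLtimes

end Realisation

end Literature.AnabelianGeometry.AbsoluteAnabelian
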